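import Summits.AtomisticToContinuum.HydrodynamicLimit.Theorems.ImplosionDichotomyPolynomialCompressionEosRatioAnalytic
import Summits.AtomisticToContinuum.HydrodynamicLimit.Theorems.OneFlightGossipEngineUniformLocalGibbsConcentrationPerturb
import Summits.AtomisticToContinuum.HydrodynamicLimit.Theorems.PolynomialCompression.Negative.Statics

/-!
# The entropy clock `ClampedWindowDock` (stmt-AtomisticToContinuum-13735), II: activity inversion

Step (vii) of the dock's informal proof ("activity representation of `(ρ_t, u_t, θ_t)` at packing `< η₀/4`"):
the reference local Gibbs law of Yau's relative-entropy method at macroscopic time `t` must have the Euler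
density `ρ_t` as its law of large numbers, i.e. one needs an ACTIVITY PROFILE `a_t` whose canonical local Gibbs
laws have limit density `ρ_t`. In the tree the limit density of the activity `a` at reduced diameter `σ` is
the explicit cluster series `rhoLim (profileOf a) σ` (`HardSphereEulerLLN`), so this is the inverse problem
`rhoLim (profileOf a) σ = ρ` — solved here EXPLICITLY and scale-free (the only smallness is on the packing
`σ³ · sup ρ`, as the `η₀`-uniform items of route TwoClocks require):

* `insertionMap_leftInverse`, `strictMonoOn_insertionMap` — the pointwise INSERTION MAP
  `F_σ(s) = s · Rf(σ³ s)` (`Rf` the analytic insertion factor of the hard-sphere gas,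
  `stub_eosRatioAnalytic`: `Rf(x) · Φ(x Rf(x)) = 1`, `Φ(u) = Σ_j bE j uʲ/j!`) has the left inverse
  `y ↦ y Φ(σ³ y)` and is therefore strictly increasing on `[0, S]` whenever `σ³ S < r`;
* `exists_activity_of_density` — **ACTIVITY INVERSION**: there is a universal `η₁ > 0` such that for
  `0 < σ < 1/2` and every continuous density `ρ > 0` of unit mass with `σ³ sup ρ ≤ η₁`, the activity
  `a := F_σ ∘ ρ` (continuous, `ρ ≤ a ≤ 2ρ`) satisfies `SmallDensity (profileOf a) σ` and
  `rhoLim (profileOf a) σ = ρ`. Proof: with `R = ratioLimit`, `β = a/∫a`, the EOS identity of the line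
  `r2-one-mode-two-conditions` gives `F_σ ∘ rhoLim = R β` pointwise (uniqueness of the root of
  `R' Φ(x R') = 1`), while `F_σ ∘ ρ = a = (∫a) β` by construction; `F_σ` is strictly monotone, so `rhoLim`
  and `ρ` are pointwise comparable in one direction, and both have unit mass
  (`integral_rhoLim_eq_one`), hence coincide. No series are differentiated or re-summed.

Imports: the EOS insertion factor (`ImplosionDichotomyPolynomialCompressionEosRatioAnalytic`), the smallness
package (`OneFlightGossipEngineUniformLocalGibbsConcentrationPerturb`) and the unit mass of `rhoLim`
(`PolynomialCompression/Negative/Statics`) — all three import Literature only; four small lemmas of the line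
`r2-one-mode-two-conditions` / the DenseExcursion negatives (`abs_phi_term_le`, `abs_phi_sub_one_le`,
`rhoLim_eq_mul_phi`, `rhoLim_lt`) are re-proved in §0 to keep this file independent of other routes' Theses
modules. prover-pitem-stmt-AtomisticToContinuum-13735-0.
-/

noncomputable section

namespace Summit.AtomisticToContinuum.HydrodynamicLimit.Theorems.EntropyClockDock

open MeasureTheory Filter Set Topology
open Literature.MathematicalPhysics.KineticTheory Literature.Analysis.FluidPDE
open Summit.AtomisticToContinuum.HydrodynamicLimit.Theorems.PolynomialCompressionStatics
open Summit.AtomisticToContinuum.HydrodynamicLimit.Theorems.UniformLGC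

/-! ### §0 The insertion series `Φ(u) = Σ_j bE j uʲ/j!` and the cluster series (PRIVATE re-proofs) -/

-- adapted from `R2OneModeTwoConditions.abs_phi_term_le` (Theorems/ImplosionDichotomyDenseExcursionR2AdmissibleData.lean)
/-- Termwise bound of the insertion series at `0 ≤ u ≤ 2Mσ³`: `|bE j uʲ/j!| ≤ e θʲ`, `θ = geomRatio P σ`.
[folklore] -/
private theorem abs_phi_term_le {P : DensityProfile} {σ : ℝ} {u : ℝ} (hu0 : 0 ≤ u) (hu : u ≤ 2 * P.M * σ ^ 3)
    (j : ℕ) : |bE j / (j.factorial : ℝ) * u ^ j| ≤ Real.exp 1 * geomRatio P σ ^ j := by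
  rw [abs_mul, abs_pow, abs_of_nonneg hu0]
  have hb := EosRatioAnalytic.abs_bE_div_factorial_le j
  have he : 0 < Real.exp 1 := Real.exp_pos 1
  have hv := v₁_pos
  have hθ : Real.exp 1 * v₁ * u ≤ geomRatio P σ := by
    rw [geomRatio, ovDensity]
    calc Real.exp 1 * v₁ * u ≤ Real.exp 1 * v₁ * (2 * P.M * σ ^ 3) :=
          mul_le_mul_of_nonneg_left hu (by positivity)
      _ = 2 * Real.exp 1 * (P.M * v₁ * σ ^ 3) := by ring
  have h0 : 0 ≤ Real.exp 1 * v₁ * u := by positivity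
  calc |bE j / (j.factorial : ℝ)| * u ^ j ≤ Real.exp 1 * (Real.exp 1 * v₁) ^ j * u ^ j := by gcongr
    _ = Real.exp 1 * (Real.exp 1 * v₁ * u) ^ j := by rw [mul_pow]; ring
    _ ≤ Real.exp 1 * geomRatio P σ ^ j := by gcongr

-- adapted from `R2OneModeTwoConditions.abs_phi_sub_one_le` (ibid.)
/-- The insertion series is close to `1`: `|Φ(u) - 1| ≤ eθ/(1-θ)` for `0 ≤ u ≤ 2Mσ³` under `SmallDensity P σ`.
[folklore] -/
private theorem abs_phi_sub_one_le {P : DensityProfile} {σ : ℝ} (h : SmallDensity P σ) {u : ℝ} (hu0 : 0 ≤ u)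
    (hu : u ≤ 2 * P.M * σ ^ 3) :
    |(∑' j : ℕ, bE j / (j.factorial : ℝ) * u ^ j) - 1| ≤
      Real.exp 1 * geomRatio P σ / (1 - geomRatio P σ) := by
  have hθ0 := h.geomRatio_nonneg
  have hθ1 := h.geomRatio_lt_one
  have hsum : Summable fun j : ℕ => bE j / (j.factorial : ℝ) * u ^ j :=
    Summable.of_norm_bounded ((summable_geometric_of_lt_one hθ0 hθ1).mul_left _) fun j =>
      (Real.norm_eq_abs _).trans_le (abs_phi_term_le hu0 hu j)
  rw [hsum.tsum_eq_zero_add, EosRatioAnalytic.bE_zero, Nat.factorial_zero, Nat.cast_one, div_one, pow_zero,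
    mul_one, add_sub_cancel_left]
  have hgeo : HasSum (fun j : ℕ => Real.exp 1 * geomRatio P σ ^ (j + 1))
      (Real.exp 1 * geomRatio P σ / (1 - geomRatio P σ)) := by
    have h' := (hasSum_geometric_of_lt_one hθ0 hθ1).mul_left (Real.exp 1 * geomRatio P σ)
    rw [div_eq_mul_inv]
    refine h'.congr_fun fun j => ?_
    rw [pow_succ]; ring
  refine (Real.norm_eq_abs _).symm.trans_le (tsum_of_norm_bounded hgeo fun j => ?_)
  exact (Real.norm_eq_abs _).trans_le (abs_phi_term_le hu0 hu (j + 1))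

-- adapted from `R2OneModeTwoConditions.rhoLim_eq_mul_phi` (ibid.)
/-- **The cluster series through the insertion series**: `rhoLim P σ x = R β(x) Φ(σ³ R β(x))`,
`R = ratioLimit P σ` (termwise: `γ_j R^{j+1} β^{j+1} = Rβ · bE j (σ³Rβ)ʲ/j!`). [folklore] -/
private theorem rhoLim_eq_mul_phi (P : DensityProfile) (σ : ℝ) (x : T3) :
    rhoLim P σ x = ratioLimit P σ * P.β x *
      ∑' j : ℕ, bE j / (j.factorial : ℝ) * (σ ^ 3 * ratioLimit P σ * P.β x) ^ j := by
  rw [rhoLim, ← tsum_mul_left]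
  refine tsum_congr fun j => ?_
  rw [clusterCoeff, mul_pow, mul_pow]
  ring

-- adapted from `DenseExcursionAtTimeZero.rhoLim_lt` (Theorems/DenseExcursion/Negative/AtTimeZero.lean)
/-- **Uniform sup bound** on the cluster-series density: `rhoLim P σ x < (2e+1)·M`, independent of `σ`. [folklore] -/
private theorem rhoLim_lt {P : DensityProfile} {σ : ℝ} (h : SmallDensity P σ) (x : T3) :
    rhoLim P σ x < (2 * Real.exp 1 + 1) * P.M := by
  have hgeo : HasSum (fun j : ℕ => 2 * Real.exp 1 * P.M * geomRatio P σ ^ j)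
      (2 * Real.exp 1 * P.M / (1 - geomRatio P σ)) := by
    rw [div_eq_mul_inv]
    exact (hasSum_geometric_of_lt_one h.geomRatio_nonneg h.geomRatio_lt_one).mul_left _
  have h1 : |rhoLim P σ x| ≤ 2 * Real.exp 1 * P.M / (1 - geomRatio P σ) :=
    (Real.norm_eq_abs _).symm.trans_le
      (tsum_of_norm_bounded hgeo fun j => (Real.norm_eq_abs _).trans_le (h.abs_rhoLim_term_le j x))
  have hθ1 := h.geomRatio_lt_one
  have hφ := h.phi_lt_half
  have hM := P.M_pos
  have hkey : 2 * Real.exp 1 * P.M / (1 - geomRatio P σ) =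
      2 * Real.exp 1 * P.M + 2 * P.M * (Real.exp 1 * geomRatio P σ / (1 - geomRatio P σ)) := by
    have hne : (1 - geomRatio P σ) ≠ 0 := (sub_pos.2 hθ1).ne'
    field_simp
    ring
  have h2 : 2 * Real.exp 1 * P.M / (1 - geomRatio P σ) < (2 * Real.exp 1 + 1) * P.M := by
    rw [hkey]; nlinarith
  exact (le_abs_self _).trans_lt (h1.trans_lt h2)

/-! ### §1 Two continuous functions of the torus that are ordered and have the same integral coincide -/

/-- On `𝕋³`, if `f ≤ g` are continuous with `∫ f = ∫ g` then `f = g` (the Haar measure charges open sets).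
[folklore] -/
theorem eq_of_le_of_integral_eq {f g : T3 → ℝ} (hf : Continuous f) (hg : Continuous g) (hle : ∀ x, f x ≤ g x)
    (hint : ∫ x, f x = ∫ x, g x) : f = g := by
  have hw : Continuous fun x => g x - f x := hg.sub hf
  have h0 : ∫ x, (g x - f x) = 0 := by
    rw [integral_sub (integrable_of_continuous_T3 hg) (integrable_of_continuous_T3 hf), hint, sub_self]
  have hae : (fun x => g x - f x) =ᵐ[volume] 0 :=
    (integral_eq_zero_iff_of_nonneg (fun x => sub_nonneg.2 (hle x)) (integrable_of_continuous_T3 hw)).1 h0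
  have heq : (fun x => g x - f x) = 0 := (Continuous.ae_eq_iff_eq volume hw continuous_const).1 hae
  funext x
  have hx := congrFun heq x
  simp only [Pi.zero_apply] at hx
  linarith

/-! ### §2 The insertion map `F_σ(s) = s · Rf(σ³ s)` -/

section Insertion

variable {r : ℝ} {Rf : ℝ → ℝ}

/-- **Left inverse of the insertion map.** If `Rf x · Φ(x Rf x) = 1` on `(-r, r)`, then for `0 ≤ s` with
`σ³ s < r` the value `y = s · Rf(σ³ s)` solves `y · Φ(σ³ y) = s`. [folklore] -/
theorem insertionMap_leftInverse
    (hsol : ∀ x ∈ Ioo (-r) r, 0 < Rf x ∧ Rf x * (∑' j : ℕ, bE j / (j.factorial : ℝ) * (x * Rf x) ^ j) = 1)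
    {σ s : ℝ} (hσ : 0 ≤ σ) (hr : 0 < r) (hs : 0 ≤ s) (hsr : σ ^ 3 * s < r) :
    s * Rf (σ ^ 3 * s) * (∑' j : ℕ, bE j / (j.factorial : ℝ) * (σ ^ 3 * (s * Rf (σ ^ 3 * s))) ^ j) = s := by
  have hx : σ ^ 3 * s ∈ Ioo (-r) r := ⟨by nlinarith [pow_nonneg hσ 3], hsr⟩
  have h := (hsol _ hx).2
  have e : σ ^ 3 * (s * Rf (σ ^ 3 * s)) = σ ^ 3 * s * Rf (σ ^ 3 * s) := by ring
  rw [e, mul_assoc, h, mul_one]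

/-- **The insertion map is strictly increasing** on `[0, S]` when `σ³ S < r`: it is continuous (`Rf` is
continuous on `[0, r]`) and injective (it has a left inverse), and `F_σ(0) = 0 ≤ F_σ(S)`. [folklore] -/
theorem strictMonoOn_insertionMap
    (hsol : ∀ x ∈ Ioo (-r) r, 0 < Rf x ∧ Rf x * (∑' j : ℕ, bE j / (j.factorial : ℝ) * (x * Rf x) ^ j) = 1)
    (hbd : ∀ x ∈ Icc 0 r, 1 ≤ Rf x ∧ Rf x ≤ 2) (hcont : ContinuousOn Rf (Icc 0 r))
    {σ S : ℝ} (hσ : 0 ≤ σ) (hr : 0 < r) (hS : 0 ≤ S) (hSr : σ ^ 3 * S < r) :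
    StrictMonoOn (fun s => s * Rf (σ ^ 3 * s)) (Icc 0 S) := by
  have hσ3 : 0 ≤ σ ^ 3 := pow_nonneg hσ 3
  have hmaps : MapsTo (fun s => σ ^ 3 * s) (Icc 0 S) (Icc 0 r) := fun s hs =>
    ⟨mul_nonneg hσ3 hs.1, (mul_le_mul_of_nonneg_left hs.2 hσ3).trans hSr.le⟩
  have hc : ContinuousOn (fun s => s * Rf (σ ^ 3 * s)) (Icc 0 S) :=
    continuousOn_id.mul (hcont.comp (continuous_const.mul continuous_id).continuousOn hmaps)
  have hinj : InjOn (fun s => s * Rf (σ ^ 3 * s)) (Icc 0 S) := by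
    intro s hs t ht hst
    have hs' := insertionMap_leftInverse hsol hσ hr hs.1 ((mul_le_mul_of_nonneg_left hs.2 hσ3).trans_lt hSr)
    have ht' := insertionMap_leftInverse hsol hσ hr ht.1 ((mul_le_mul_of_nonneg_left ht.2 hσ3).trans_lt hSr)
    simp only at hst
    rw [← hs', ← ht', hst]
  refine hc.strictMonoOn_of_injOn_Icc hS ?_ hinj
  simp only [zero_mul]
  exact mul_nonneg hS (zero_le_one.trans (hbd _ (hmaps (right_mem_Icc.2 hS))).1)

end Insertion

/-! ### §3 Activity inversion -/

/-- The supremum of the density profile of an activity `a ≤ 2ρ` with `∫ a ≥ 1` is at most `2 sup ρ`. [folklore] -/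
theorem profileOf_M_le {a ρ : T3 → ℝ} (ha : Continuous a) (ha0 : ∀ x, 0 < a x) (hρ : Continuous ρ)
    (hle : ∀ x, a x ≤ 2 * ρ x) (hint : 1 ≤ ∫ x, a x) :
    (profileOf a ha ha0).M ≤ 2 * ⨆ x, ρ x := by
  have hbdd : BddAbove (Set.range ρ) := (isCompact_range hρ).bddAbove
  refine csSup_le (Set.range_nonempty _) ?_
  rintro _ ⟨x, rfl⟩
  rw [profileOf_β]
  have h1 : a x / ∫ y, a y ≤ a x := div_le_self (ha0 x).le hint
  exact h1.trans ((hle x).trans (mul_le_mul_of_nonneg_left (le_ciSup hbdd x) zero_le_two))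

/-- **ACTIVITY INVERSION through a given insertion factor.** Let `Rf` be an insertion factor on `(-r, r)`
(`Rf x · Φ(x Rf x) = 1`, `1 ≤ Rf ≤ 2` and continuous on `[0, r]`, and `Rf x` the unique root in `[1/2, 2]`; the
tree's `stub_eosRatioAnalytic` provides one, analytic). For `0 < σ < 1/2` and a continuous density `ρ > 0` of unit
mass with packing `σ³ · sup ρ ≤ min (r/(8e+4)) (1/(64 e v₁))`, the EXPLICIT activity `a := fun x => ρ x · Rf(σ³ ρ x)`
(`ρ ≤ a ≤ 2ρ`) is in the statics regime and its canonical local Gibbs laws have limit density exactly `ρ`: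
`SmallDensity (profileOf a) σ ∧ rhoLim (profileOf a) σ = ρ`. (Along an Euler solution, `s ↦ ρ_s · Rf(σ³ρ_s)` is
then a reference family as smooth in `s` as `ρ`.) [folklore] -/
theorem activity_of_density {r : ℝ} {Rf : ℝ → ℝ} (hr : 0 < r)
    (hsol : ∀ x ∈ Ioo (-r) r, 0 < Rf x ∧ Rf x * (∑' j : ℕ, bE j / (j.factorial : ℝ) * (x * Rf x) ^ j) = 1)
    (hbd : ∀ x ∈ Icc 0 r, 1 ≤ Rf x ∧ Rf x ≤ 2) (hcont : ContinuousOn Rf (Icc 0 r))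
    (huniq : ∀ x ∈ Ioo (-r) r, ∀ R ∈ Icc (1 / 2 : ℝ) 2,
      R * (∑' j : ℕ, bE j / (j.factorial : ℝ) * (x * R) ^ j) = 1 → R = Rf x)
    {σ : ℝ} (hσ : 0 < σ) (hσ2 : σ < 1 / 2) {ρ : T3 → ℝ} (hρc : Continuous ρ) (hρ0 : ∀ x, 0 < ρ x)
    (hρ1 : (∫ x, ρ x) = 1)
    (hpack : σ ^ 3 * (⨆ x, ρ x) ≤ min (r / (2 * (2 * (2 * Real.exp 1 + 1)))) (1 / (64 * Real.exp 1 * v₁))) :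
    ∃ (ha : Continuous fun x => ρ x * Rf (σ ^ 3 * ρ x)) (ha0 : ∀ x, 0 < ρ x * Rf (σ ^ 3 * ρ x)),
      (∀ x, ρ x ≤ ρ x * Rf (σ ^ 3 * ρ x) ∧ ρ x * Rf (σ ^ 3 * ρ x) ≤ 2 * ρ x) ∧
      SmallDensity (profileOf (fun x => ρ x * Rf (σ ^ 3 * ρ x)) ha ha0) σ ∧
      rhoLim (profileOf (fun x => ρ x * Rf (σ ^ 3 * ρ x)) ha ha0) σ = ρ := by
  -- the packing threshold
  set K : ℝ := 2 * (2 * Real.exp 1 + 1) with hK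
  have he0 : 0 < Real.exp 1 := Real.exp_pos 1
  have hK1 : 1 ≤ K := by rw [hK]; nlinarith
  have hK0 : 0 < K := by linarith
  have hv := v₁_pos
  have hσ3 : 0 < σ ^ 3 := pow_pos hσ 3
  have hbddρ : BddAbove (Set.range ρ) := (isCompact_range hρc).bddAbove
  have hρsup : ∀ x, ρ x ≤ ⨆ y, ρ y := fun x => le_ciSup hbddρ x
  have hsup0 : 0 < ⨆ y, ρ y := (hρ0 0).trans_le (hρsup 0)
  have hpackr : σ ^ 3 * (⨆ x, ρ x) ≤ r / (2 * K) := hpack.trans (min_le_left _ _)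
  have hpackv : σ ^ 3 * (⨆ x, ρ x) ≤ 1 / (64 * Real.exp 1 * v₁) := hpack.trans (min_le_right _ _)
  -- `S = K sup ρ` bounds both `ρ` and `rhoLim`, and `σ³ S < r`
  set S : ℝ := K * ⨆ x, ρ x with hS
  have hS0 : 0 ≤ S := by positivity
  have hSr : σ ^ 3 * S < r := by
    have h1 : σ ^ 3 * S = K * (σ ^ 3 * ⨆ x, ρ x) := by rw [hS]; ring
    rw [h1]
    calc K * (σ ^ 3 * ⨆ x, ρ x) ≤ K * (r / (2 * K)) := by gcongr
      _ = r / 2 := by field_simp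
      _ < r := by linarith
  have hρS : ∀ x, ρ x ≤ S := fun x =>
    (hρsup x).trans (le_mul_of_one_le_left hsup0.le hK1)
  have hρr : ∀ x, σ ^ 3 * ρ x < r := fun x =>
    (mul_le_mul_of_nonneg_left (hρS x) hσ3.le).trans_lt hSr
  have hρmem : ∀ x, σ ^ 3 * ρ x ∈ Icc 0 r := fun x => ⟨(mul_pos hσ3 (hρ0 x)).le, (hρr x).le⟩
  -- the activity
  set a : T3 → ℝ := fun x => ρ x * Rf (σ ^ 3 * ρ x) with hadef
  have ha : Continuous a := by
    refine hρc.mul (hcont.comp_continuous (continuous_const.mul hρc) hρmem)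
  have hale : ∀ x, ρ x ≤ a x ∧ a x ≤ 2 * ρ x := fun x => by
    have hb := hbd _ (hρmem x)
    constructor
    · simpa [hadef] using mul_le_mul_of_nonneg_left hb.1 (hρ0 x).le
    · have := mul_le_mul_of_nonneg_left hb.2 (hρ0 x).le
      simpa [hadef, mul_comm] using this
  have ha0 : ∀ x, 0 < a x := fun x => (hρ0 x).trans_le (hale x).1
  have hinta : 1 ≤ ∫ x, a x := by
    have h := integral_mono (integrable_of_continuous_T3 hρc) (integrable_of_continuous_T3 ha) fun x => (hale x).1
    linarith [hρ1]
  have hinta0 : 0 < ∫ x, a x := one_pos.trans_le hinta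
  set Q := profileOf a ha ha0 with hQ
  have hMQ : Q.M ≤ 2 * ⨆ x, ρ x := profileOf_M_le ha ha0 hρc (fun x => (hale x).2) hinta
  -- statics regime
  have hη : Real.exp 1 * ((2 * ⨆ x, ρ x) * v₁ * σ ^ 3) ≤ 1 / 32 := by
    have h1 : Real.exp 1 * ((2 * ⨆ x, ρ x) * v₁ * σ ^ 3) =
        (2 * Real.exp 1 * v₁) * (σ ^ 3 * ⨆ x, ρ x) := by ring
    rw [h1]
    calc (2 * Real.exp 1 * v₁) * (σ ^ 3 * ⨆ x, ρ x) ≤ (2 * Real.exp 1 * v₁) * (1 / (64 * Real.exp 1 * v₁)) := by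
          gcongr
      _ = 1 / 32 := by field_simp; ring
  have hQs : SmallDensity Q σ := smallDensity_of_eta_le hσ hσ2 hMQ hη
  refine ⟨ha, ha0, hale, hQs, ?_⟩
  -- the two representations through the insertion map
  set R := ratioLimit Q σ with hRdef
  have hR := hQs.ratioLimit_mem
  have hR0 := hQs.ratioLimit_pos
  have hrho_lt : ∀ x, rhoLim Q σ x < S := fun x => by
    have h1 := rhoLim_lt hQs x
    have hM0 := Q.M_pos
    calc rhoLim Q σ x < (2 * Real.exp 1 + 1) * Q.M := h1
      _ ≤ (2 * Real.exp 1 + 1) * (2 * ⨆ y, ρ y) := by gcongr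
      _ = S := by rw [hS, hK]; ring
  -- `F(rhoLim x) = R β x` (and `rhoLim > 0`)
  have hrep : ∀ x, 0 < rhoLim Q σ x ∧ rhoLim Q σ x * Rf (σ ^ 3 * rhoLim Q σ x) = R * Q.β x := by
    intro x
    set u := σ ^ 3 * R * Q.β x with hu
    set Φu := ∑' j : ℕ, bE j / (j.factorial : ℝ) * u ^ j with hΦu
    have hβ0 : 0 < Q.β x := Q.pos x
    have hu0 : 0 ≤ u := by positivity
    have huM : u ≤ 2 * Q.M * σ ^ 3 := by
      have h1 : R * Q.β x ≤ 2 * Q.M := mul_le_mul hR.2 (Q.le_M x) hβ0.le zero_le_two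
      calc u = σ ^ 3 * (R * Q.β x) := by rw [hu]; ring
        _ ≤ σ ^ 3 * (2 * Q.M) := by gcongr
        _ = 2 * Q.M * σ ^ 3 := by ring
    have hΦ1 := abs_phi_sub_one_le hQs hu0 huM
    rw [← hΦu, abs_le] at hΦ1
    have hφ := hQs.phi_lt_half
    have hΦlo : 1 / 2 < Φu := by linarith [hΦ1.1]
    have hΦhi : Φu < 3 / 2 := by linarith [hΦ1.2]
    have hΦpos : 0 < Φu := by linarith
    have hΦmem : Φu⁻¹ ∈ Icc (1 / 2 : ℝ) 2 := by
      constructor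
      · rw [le_inv_comm₀ (by norm_num) hΦpos]; linarith
      · rw [inv_le_comm₀ hΦpos (by norm_num)]; linarith
    have hn : rhoLim Q σ x = R * Q.β x * Φu := rhoLim_eq_mul_phi Q σ x
    have hnσ : rhoLim Q σ x * σ ^ 3 = u * Φu := by rw [hn, hu]; ring
    have hnpos : 0 < rhoLim Q σ x := by rw [hn]; positivity
    have hmem : σ ^ 3 * rhoLim Q σ x ∈ Ioo (-r) r := by
      refine ⟨?_, (mul_le_mul_of_nonneg_left (hrho_lt x).le hσ3.le).trans_lt hSr⟩
      have := mul_pos hσ3 hnpos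
      linarith
    -- uniqueness of the root: `Rf (σ³ rhoLim) = Φ(u)⁻¹`
    have hRf : Φu⁻¹ = Rf (σ ^ 3 * rhoLim Q σ x) := by
      refine huniq _ hmem _ hΦmem ?_
      rw [mul_comm (σ ^ 3) (rhoLim Q σ x), hnσ,
        show u * Φu * Φu⁻¹ = u from mul_inv_cancel_right₀ hΦpos.ne' u, ← hΦu]
      exact inv_mul_cancel₀ hΦpos.ne'
    refine ⟨hnpos, ?_⟩
    rw [← hRf, hn, mul_assoc, mul_inv_cancel₀ hΦpos.ne', mul_one]
  -- `F(ρ x) = (∫a) β x`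
  have hrep' : ∀ x, ρ x * Rf (σ ^ 3 * ρ x) = (∫ y, a y) * Q.β x := by
    intro x
    rw [hQ, profileOf_β, mul_div_cancel₀ _ hinta0.ne']
  -- monotonicity of the insertion map on `[0, S]`
  have hmono := strictMonoOn_insertionMap hsol hbd hcont hσ.le hr hS0 hSr
  have hmemρ : ∀ x, ρ x ∈ Icc 0 S := fun x => ⟨(hρ0 x).le, hρS x⟩
  have hmemn : ∀ x, rhoLim Q σ x ∈ Icc 0 S := fun x => ⟨(hrep x).1.le, (hrho_lt x).le⟩
  have hmass : ∫ x, rhoLim Q σ x = ∫ x, ρ x := by rw [integral_rhoLim_eq_one hQs, hρ1]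
  rcases le_total R (∫ y, a y) with hle | hle
  · -- `F ∘ rhoLim = Rβ ≤ (∫a)β = F ∘ ρ`, so `rhoLim ≤ ρ`; equal masses
    refine eq_of_le_of_integral_eq hQs.continuous_rhoLim hρc (fun x => ?_) hmass
    have h1 : rhoLim Q σ x * Rf (σ ^ 3 * rhoLim Q σ x) ≤ ρ x * Rf (σ ^ 3 * ρ x) := by
      rw [(hrep x).2, hrep' x]
      exact mul_le_mul_of_nonneg_right hle (Q.pos x).le
    exact (hmono.le_iff_le (hmemn x) (hmemρ x)).1 h1
  · refine (eq_of_le_of_integral_eq hρc hQs.continuous_rhoLim (fun x => ?_) hmass.symm).symm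
    have h1 : ρ x * Rf (σ ^ 3 * ρ x) ≤ rhoLim Q σ x * Rf (σ ^ 3 * rhoLim Q σ x) := by
      rw [(hrep x).2, hrep' x]
      exact mul_le_mul_of_nonneg_right hle (Q.pos x).le
    exact (hmono.le_iff_le (hmemρ x) (hmemn x)).1 h1

/-- **ACTIVITY INVERSION (scale-free).** There is a universal `η₁ > 0` such that for every reduced diameter
`0 < σ < 1/2` and every continuous density `ρ > 0` on `𝕋³` of unit mass with packing `σ³ · sup ρ ≤ η₁`, some
continuous activity `a` with `ρ ≤ a ≤ 2ρ` is in the statics regime `SmallDensity (profileOf a) σ` and its canonical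
local Gibbs laws have limit density EXACTLY `ρ`: `rhoLim (profileOf a) σ = ρ` (`activity_of_density` with the
insertion factor of `stub_eosRatioAnalytic`). [folklore] -/
theorem exists_activity_of_density :
    ∃ η₁ : ℝ, 0 < η₁ ∧ ∀ σ : ℝ, 0 < σ → σ < 1 / 2 → ∀ ρ : T3 → ℝ, Continuous ρ → (∀ x, 0 < ρ x) →
      (∫ x, ρ x) = 1 → σ ^ 3 * (⨆ x, ρ x) ≤ η₁ →
      ∃ (a : T3 → ℝ) (ha : Continuous a) (ha0 : ∀ x, 0 < a x),
        (∀ x, ρ x ≤ a x ∧ a x ≤ 2 * ρ x) ∧ SmallDensity (profileOf a ha ha0) σ ∧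
        rhoLim (profileOf a ha ha0) σ = ρ := by
  obtain ⟨r, hr, Rf, -, -, -, hsol, hbd, hLip, huniq⟩ := stub_eosRatioAnalytic
  have hcont : ContinuousOn Rf (Icc 0 r) := by
    obtain ⟨L, hL⟩ := hLip
    exact hL.continuousOn
  refine ⟨min (r / (2 * (2 * (2 * Real.exp 1 + 1)))) (1 / (64 * Real.exp 1 * v₁)),
    lt_min (by positivity) (by have := v₁_pos; positivity), fun σ hσ hσ2 ρ hρc hρ0 hρ1 hpack => ?_⟩
  obtain ⟨ha, ha0, hale, hQs, hlim⟩ := activity_of_density hr hsol hbd hcont huniq hσ hσ2 hρc hρ0 hρ1 hpack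
  exact ⟨_, ha, ha0, hale, hQs, hlim⟩

end Summit.AtomisticToContinuum.HydrodynamicLimit.Theorems.EntropyClockDock

end
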